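import Summits.Parity.GeneralizedHardyLittlewood.Theses.ParityLeakOneFifth
import Literature.NumberTheory.LFunctions.RHWave0PNTProofs

/-!
# Line `birth` — BC3 skeleton for the crux `PintzDensity` (stmt-Parity-18378)

Route `ParityLeakOneFifth` (route-Parity-ParityLeakOneFifth), sub-problem `GeneralizedHardyLittlewood`,
crux (rank 2, deciding; by name
`Summit.Parity.GeneralizedHardyLittlewood.Theses.ParityLeakOneFifth.PintzDensity`):

  `∃ κ < 1, ∃ x₀, ∀ x ≥ x₀, Σ_{x < p ≤ 2x} log p · λ(p+2) ≤ κ·x`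

— Pintz's problem in DENSITY form: `Ω(p+2)` is odd for a positive (log-weighted) proportion of the primes
of every large dyadic window.

## The line: TYPE-I/II INFORMATION FOR `λ(·+2)` ⟶ FORD–MAYNARD BOUNDED SIEVE AT `ν = 1/5` ⟶ PNT BOOKKEEPING

This is the route header's own TWO-LAYER PLAN for K1 ("PintzDensity ⇐ TypeIILiouvilleLopsided →
(TypeIILiouvilleLopsided → PintzDensity) [Ford–Maynard Thm 2.7(b) on the bounded host (1 − λ(n+2))/2]"),
de-costumed: the bridge `TypeII → PintzDensity` is NOT a stub here; instead the published sieve theorem is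
stated GENERICALLY (every host `0 ≤ a_n ≤ 2` against the comparison `b_n = 1`), the Type-I input is named
separately, and the passage from the sieve output `Σ_{X<p≤2X} (1 − λ(p+2)) ≥ cX/log X` to the crux's
log-weighted form is PROVED here from the tree's prime number theorem
(`Literature.NumberTheory.LFunctions.chebyshevTheta_isEquivalent`, `ϑ(x) ∼ x`).

Objects (all over Mathlib; `X : ℕ`, window `(X, 2X]`, i.e. Ford–Maynard's `(x/2, x]` with `x = 2X`):

* `shiftedLiouville n = λ(n+2)` (real-valued), the host's parity weight; the host is `a_n = 1 − λ(n+2) ∈ {0,2}`,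
  the comparison sequence is `b_n = 1`, so `w_n = a_n − b_n = −λ(n+2)`.
* `TypeIBound w γ B X` — Ford–Maynard's Type-I estimate (I) (arXiv:2407.14368 §1, p. 3) for the weight `w`
  at level `X^γ` with exponent `B`: for every choice of intervals `(u m, v m]`,
  `Σ_{m ≤ X^γ} τ(m)^B · |Σ_{n ∈ (u m, v m], X < mn ≤ 2X} w(mn)| ≤ X/(log X)^B`
  (the `max` over intervals of (I) is the `∀ u v`).
* `TypeIIBound w θ σ B X` — Ford–Maynard's Type-II estimate (II) (ibid.): for all complex coefficients with
  `‖ξ_m‖ ≤ τ(m)^B`, `‖κ_n‖ ≤ τ(n)^B`,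
  `‖Σ_{X^θ < m ≤ X^σ} Σ_{X < mn ≤ 2X} ξ_m κ_n w(mn)‖ ≤ X/(log X)^B`.

The three registered OPEN stubs:

* `stub_typeI_liouville_half` (I-λ; size M/L; a THEOREM in print, not in the tree): for every `ε > 0` and
  every `B`, eventually in `X`, `TypeIBound λ(·+2) (1/2 − ε) B X` — Bombieri–Vinogradov for the Liouville
  function in the residue classes `−2 (mod m)` with interval maxima and `τ(m)^B` weights (Siegel–Walfisz for
  `λ` + large sieve; Motohashi's generalized BV; the `τ^B` weight by Cauchy–Schwarz against the trivial bound).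
  Why it might fail: only through the non-coprime classes `2 | m` (reduce `λ(2k') = −λ(k')` to the class
  `1 mod m/2`) or the `τ^B` weights — both standard. Sources: Motohashi1976 (tree def
  `Literature.NumberTheory.Sieve.Motohashi1976_generalizedBombieriVinogradov`), IwaniecKowalski2004 Thm 17.4,
  arXiv:2407.14368 §1.
* `stub_typeII_liouville_lopsided` (II-λ, LOPSIDED; the research content, OPEN): for every `ε > 0` and every
  `B`, eventually in `X`, `TypeIIBound λ(·+2) ε (1/5 − ε) B X` — power-of-log cancellation in bilinear forms
  `Σ ξ_m κ_n λ(mn+2)` with `m ∈ (X^ε, X^{1/5−ε}]` tiny and `n ≍ X/m` huge. By Cauchy–Schwarz in `n` it is the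
  two-point correlation `Σ_n λ(mn+2)λ(m′n+2) = o` along DILATED progressions, uniformly in `m ≠ m′ ≤ X^{1/5}`
  — natural density, not logarithmic. It is implied (dyadic boxes + Perron separation of `X < mn ≤ 2X`) by the
  hub's balanced-range statement `LiouvilleMAD.TypeIILiouville` at `c = 2` (power saving `N^{-1/2} + M^{-η}`).
  Why it might fail: it is a binary Chowla-type statement for the pair of forms `(mn+2, m′n+2)`; false only
  through a conspiracy of `λ` along dilated progressions at some scale (none known; true under Chowla-type
  heuristics). Sources: arXiv:2407.14368 Thm 2.7 (the range), Harman2007 §14.2, MatomakiRadziwillTao (sign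
  patterns), TaoTeravainen2019 (log-averaged structure), tree `Summit.…LiouvilleMAD.TypeIILiouville`.
* `stub_bounded_sieve_one_fifth` (FM/DFI bounded sieve at the corner `(γ, θ, ν) = (1/2, 0, 1/5)`; size XL;
  a THEOREM in print): there are `ε > 0`, `B`, `c > 0` such that for all large `X` and EVERY host
  `0 ≤ a_n ≤ 2`, `TypeIBound (a − 1) (1/2 − ε) B X` and `TypeIIBound (a − 1) ε (1/5 − ε) B X` imply
  `Σ_{X < p ≤ 2X} a_p ≥ c·X/log X`. Derivation from print: Ford–Maynard Thm 2.7(a) gives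
  `lim_{ε′→0⁺} 𝒞_𝔅⁻(1/2 − ε′, ε′, 1/5 − 2ε′; ϱ) = C⁻(1/2, 0, 1/5) = 0.362… > 0` for every fixed `ϱ ≥ 1`
  (Duke–Friedlander–Iwaniec 1997 independently: `≥ 0.23` at `ϱ = 1`); unfold Def. 4.9 with `ϱ = 3`,
  `ϖ = 2`, comparison `b_n = 1` on `(x/2, x]` (hypotheses (b.1), (b.2) by Lemma 4.6 with `q = 1`, `y = x/2`;
  (w) and (CBD) since `|w_n| ≤ 1 ≤ τ(n)^ϱ` and `π(x) − π(x/2) ≥ x/(3 log x)`), take `ε < ε′`, `B ≥ B₀(ϖ, C)`: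
  our `TypeIBound`/`TypeIIBound` at scale `X` with exponent `B` imply (I)/(II) at scale `x = 2X` with `B₀`
  (larger `m`-ranges only add non-negative terms to (I) / are absorbed by zero-extension of `ξ` in (II);
  `X/(log X)^B ≤ 2X/(log 2X)^{B₀}` for large `X`), and `Σ_p a_p ≥ 0.3·(π(2X) − π(X)) ≥ 0.1·X/log X`.
  Why it might fail: only by a mis-transcription of (I)/(II)/(CBD) in `TypeIBound`/`TypeIIBound` (checked
  against arXiv:2407.14368 pp. 3, 5, 13 line by line); the constant `0.362` has two independent proofs.
  Sources: arXiv:2407.14368 Thm 2.7 + Def 4.9 + Lemma 4.6, DukeFriedlanderIwaniec1997, Harman2007 §14.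

Composition (sorry-free): `PintzDensity_of_bounds` takes the three stub STATEMENTS as hypotheses and proves the
crux's literal body — host `a = 1 − λ(·+2)` (values in `{0, 2}`, `typeI_neg`/`typeII_neg` move the sign),
sieve output `c·X/log X ≤ Σ_{X<p≤2X} (1 − λ(p+2))`, the pointwise inequality
`log p·λ(p+2) ≤ log p − log X·(1 − λ(p+2))` for `X < p`, the identity `Σ_{X<p≤2X} log p = ϑ(2X) − ϑ(X)`
(`sum_log_window`) and the PNT bound `ϑ(2X) − ϑ(X) ≤ (1 + 3c/8)·X` give `κ = 1 − c/2`.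
`PintzDensity_of : PintzDensity` (zero hypotheses) instantiates it on the stubs and concludes the crux BY NAME.

BC3 probes (registrar folder `bc/PintzDensity_probes.lean`, a file WITHOUT `PintzDensity_of`): for each stub
`S`, `example : S → PintzDensity` and `example : S → GeneralizedHardyLittlewood` by
`first | exact? | simpa | aesop` FAIL (verdicts quoted in `Lines/birth.md`). No stub is the crux or the summit
in costume: (I-λ) is a level-of-distribution statement with no sign content, (II-λ) is a bilinear cancellation
statement blind to primes, and the sieve stub is a theorem about ALL bounded hosts.

Disproof used: none on file (`ledger crux ls stmt-Parity-18378`: no workfiles, no `Disproof.lean`, no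
`Negative/` lemma at registration, 2026-08-17). Negatives index (`ledger negatives --problem Parity`): no entry is
a Type-I/Type-II or sieve statement for `λ(·+2)`; no stub restates one.

`sorry` occurs ONLY in the three `stub_*` theorems (sorries = 3 = stubs); everything else is kernel-checked.
-/

namespace Summit.Parity.GeneralizedHardyLittlewood.Cruxes.PintzDensity.Birth

open Filter Finset Asymptotics
open scoped BigOperators Topology
open Summit.Parity.GeneralizedHardyLittlewood.Theses.ParityLeakOneFifth (PintzDensity)

/-! ## The objects, named -/

/-- The host's parity weight `λ(n+2)` as a real number (`λ` = Mathlib's `ArithmeticFunction.liouville`). -/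
noncomputable def shiftedLiouville (n : ℕ) : ℝ := (ArithmeticFunction.liouville (n + 2) : ℝ)

/-- **Ford–Maynard Type-I estimate (I)** for a weight `w` on the window `(X, 2X]`, level `X^γ`, exponent `B`
(arXiv:2407.14368 §1 (I), with `x = 2X`; the maximum over intervals `I ∋ n` is the universal quantifier over
the interval ends `u m < n ≤ v m`):
`Σ_{1 ≤ m ≤ X^γ} τ(m)^B · |Σ_{u m < n ≤ v m, X < mn ≤ 2X} w(mn)| ≤ X / (log X)^B`. -/
def TypeIBound (w : ℕ → ℝ) (γ : ℝ) (B X : ℕ) : Prop :=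
  ∀ u v : ℕ → ℕ,
    (∑ m ∈ (Finset.Icc 1 (2 * X)).filter (fun m : ℕ => (m : ℝ) ≤ (X : ℝ) ^ γ),
        ((Nat.divisors m).card : ℝ) ^ B *
          |∑ n ∈ (Finset.Ioc (u m) (v m)).filter (fun n : ℕ => X < m * n ∧ m * n ≤ 2 * X), w (m * n)|)
      ≤ (X : ℝ) / Real.log (X : ℝ) ^ B

/-- **Ford–Maynard Type-II estimate (II)** for a weight `w` on the window `(X, 2X]`, range `m ∈ (X^θ, X^σ]`,
exponent `B` (arXiv:2407.14368 §1 (II), with `x = 2X`): for all complex coefficient sequences with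
`‖ξ m‖ ≤ τ(m)^B`, `‖κ n‖ ≤ τ(n)^B`,
`‖Σ_{X^θ < m ≤ X^σ} Σ_{X < mn ≤ 2X} ξ_m κ_n w(mn)‖ ≤ X / (log X)^B`. -/
def TypeIIBound (w : ℕ → ℝ) (θ σ : ℝ) (B X : ℕ) : Prop :=
  ∀ ξ κ : ℕ → ℂ, (∀ m : ℕ, ‖ξ m‖ ≤ ((Nat.divisors m).card : ℝ) ^ B) →
    (∀ n : ℕ, ‖κ n‖ ≤ ((Nat.divisors n).card : ℝ) ^ B) →
      ‖∑ m ∈ (Finset.Icc 1 (2 * X)).filter (fun m : ℕ => (X : ℝ) ^ θ < (m : ℝ) ∧ (m : ℝ) ≤ (X : ℝ) ^ σ),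
          ∑ n ∈ (Finset.Icc 1 (2 * X)).filter (fun n : ℕ => X < m * n ∧ m * n ≤ 2 * X),
            ξ m * κ n * ((w (m * n) : ℝ) : ℂ)‖
        ≤ (X : ℝ) / Real.log (X : ℝ) ^ B

/-! ## The three registered OPEN stubs -/

/-- **Stub I-λ — Bombieri–Vinogradov for `λ(·+2)` in Ford–Maynard's Type-I form, level `1/2 − ε`.**
For every `ε > 0` and every exponent `B`, for all large `X`: `TypeIBound λ(·+2) (1/2 − ε) B X`.
A theorem in print (Siegel–Walfisz for `λ` + large sieve / Motohashi's generalized Bombieri–Vinogradov; the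
`τ(m)^B` weights by Cauchy–Schwarz against the trivial bound `X/m`), not yet in the tree.
Why it might fail: only via the non-coprime classes `2 ∣ m` (reduced by `λ(2k) = −λ(k)`) — standard.
Sources: Motohashi1976, IwaniecKowalski2004 Thm 17.4, arXiv:2407.14368 §1 (I). -/
theorem stub_typeI_liouville_half :
    ∀ ε : ℝ, 0 < ε → ∀ B : ℕ, ∃ X₀ : ℕ, ∀ X : ℕ, X₀ ≤ X →
      TypeIBound shiftedLiouville (1 / 2 - ε) B X := by
  sorry

/-- **Stub II-λ (LOPSIDED) — the research content.** For every `ε > 0` and every exponent `B`, for all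
large `X`: `TypeIIBound λ(·+2) ε (1/5 − ε) B X`, i.e. power-of-log cancellation in
`Σ_{X^ε < m ≤ X^{1/5−ε}} Σ_{X < mn ≤ 2X} ξ_m κ_n λ(mn+2)` for all divisor-bounded complex coefficients.
By Cauchy–Schwarz in `n` this is two-point Chowla along dilated progressions, `Σ_n λ(mn+2)λ(m′n+2) = o`,
uniformly in `m ≠ m′ ≤ X^{1/5}` (natural density). Implied by the hub's `LiouvilleMAD.TypeIILiouville`
(`c = 2`, power saving) after dyadic decomposition and Perron separation of `X < mn ≤ 2X`. OPEN.
Why it might fail: only through a conspiracy of `λ` along dilated progressions at some scale; none is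
known and Chowla-type heuristics predict square-root cancellation.
Sources: arXiv:2407.14368 Thm 2.7 (range `ν ≥ 0.1663`), Harman2007 §14.2, TaoTeravainen2019. -/
theorem stub_typeII_liouville_lopsided :
    ∀ ε : ℝ, 0 < ε → ∀ B : ℕ, ∃ X₀ : ℕ, ∀ X : ℕ, X₀ ≤ X →
      TypeIIBound shiftedLiouville ε (1 / 5 - ε) B X := by
  sorry

/-- **Stub FM — the Ford–Maynard / Duke–Friedlander–Iwaniec bounded sieve at `(γ, θ, ν) = (1/2, 0, 1/5)`,
comparison sequence `1`.** There are `ε > 0`, an exponent `B` and `c > 0` such that for all large `X` and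
EVERY host `a` with `0 ≤ a_n ≤ 2`: Type-I for `a − 1` at level `X^{1/2−ε}` and Type-II for `a − 1` on
`m ∈ (X^ε, X^{1/5−ε}]` (both with exponent `B`) imply `Σ_{X < p ≤ 2X} a_p ≥ c·X/log X`.
A theorem in print: Ford–Maynard Thm 2.7(a) (`C⁻(1/2,0,1/5) = lim 𝒞_𝔅⁻(1/2−ε′, ε′, 1/5−2ε′; ϱ) = 0.362…`),
unfolded through Def. 4.9 (`ϱ = 3`, `ϖ = 2`), Lemma 4.6 (`b_n = 1`, `q = 1`, `y = x/2`) and Chebyshev's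
`π(2X) − π(X) ≫ X/log X`; independently Duke–Friedlander–Iwaniec 1997 (`≥ 0.23`). Size XL to formalise.
Why it might fail: only by a mis-transcription of (I)/(II)/(CBD) into `TypeIBound`/`TypeIIBound`.
Sources: arXiv:2407.14368 Thm 2.7, Def 4.9, Lemma 4.6; DukeFriedlanderIwaniec1997; Harman2007 §14. -/
theorem stub_bounded_sieve_one_fifth :
    ∃ ε : ℝ, 0 < ε ∧ ∃ B : ℕ, ∃ c : ℝ, 0 < c ∧ ∃ X₀ : ℕ, ∀ X : ℕ, X₀ ≤ X →
      ∀ a : ℕ → ℝ, (∀ n : ℕ, 0 ≤ a n ∧ a n ≤ 2) →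
        TypeIBound (fun n => a n - 1) (1 / 2 - ε) B X →
        TypeIIBound (fun n => a n - 1) ε (1 / 5 - ε) B X →
          c * (X : ℝ) / Real.log (X : ℝ) ≤ ∑ p ∈ (Finset.Ioc X (2 * X)).filter Nat.Prime, a p := by
  sorry

/-! ## Sorry-free glue -/

/-- `λ(n+2) ∈ {1, −1}`. [folklore] -/
theorem shiftedLiouville_eq_or (n : ℕ) : shiftedLiouville n = 1 ∨ shiftedLiouville n = -1 := by
  unfold shiftedLiouville
  rw [ArithmeticFunction.liouville_apply (by omega : n + 2 ≠ 0)]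
  push_cast
  exact neg_one_pow_eq_or ℝ _

/-- Type-I bounds are insensitive to the sign of the weight. [folklore] -/
theorem typeI_neg {w : ℕ → ℝ} {γ : ℝ} {B X : ℕ} (h : TypeIBound w γ B X) :
    TypeIBound (fun n => -w n) γ B X := by
  intro u v
  simpa only [Finset.sum_neg_distrib, abs_neg] using h u v

/-- Type-II bounds are insensitive to the sign of the weight. [folklore] -/
theorem typeII_neg {w : ℕ → ℝ} {θ σ : ℝ} {B X : ℕ} (h : TypeIIBound w θ σ B X) :
    TypeIIBound (fun n => -w n) θ σ B X := by
  intro ξ κ hξ hκ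
  have h' := h ξ κ hξ hκ
  simpa only [Complex.ofReal_neg, mul_neg, Finset.sum_neg_distrib, norm_neg] using h'

/-- `Σ_{X < p ≤ 2X} log p = ϑ(2X) − ϑ(X)` (Mathlib's `Chebyshev.theta`). [folklore] -/
theorem sum_log_window (X : ℕ) :
    ∑ p ∈ (Finset.Ioc X (2 * X)).filter Nat.Prime, Real.log (p : ℝ)
      = Chebyshev.theta ((2 * X : ℕ) : ℝ) - Chebyshev.theta (X : ℝ) := by
  simp only [Chebyshev.theta, Nat.floor_natCast]
  rw [Finset.sum_filter, Finset.sum_filter, Finset.sum_filter,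
    ← Finset.sum_Ioc_consecutive _ (Nat.zero_le X) (by omega : X ≤ 2 * X)]
  ring

/-- **PNT bookkeeping.** For every `δ > 0`, eventually `|ϑ(X) − X| ≤ δX` and `|ϑ(2X) − 2X| ≤ 2δX` along
the naturals (from the tree's `ϑ(x) ∼ x`). [cite: MontgomeryVaughan2007, §8.1 eq. (8.3)] -/
theorem theta_window_eventually {δ : ℝ} (hδ : 0 < δ) :
    ∃ X₀ : ℕ, ∀ X : ℕ, X₀ ≤ X →
      |Chebyshev.theta (X : ℝ) - X| ≤ δ * X ∧
      |Chebyshev.theta ((2 * X : ℕ) : ℝ) - (2 * X : ℕ)| ≤ δ * (2 * X : ℕ) := by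
  have hPNT := Literature.NumberTheory.LFunctions.chebyshevTheta_isEquivalent
  have hev : ∀ᶠ x : ℝ in atTop, |Chebyshev.theta x - x| ≤ δ * x := by
    filter_upwards [hPNT.isLittleO.def hδ, eventually_ge_atTop (0 : ℝ)] with x hx hx0
    simpa [Pi.sub_apply, Real.norm_eq_abs, abs_of_nonneg hx0] using hx
  obtain ⟨T, hT⟩ := Filter.eventually_atTop.1 hev
  refine ⟨⌈T⌉₊, fun X hX => ?_⟩
  have hXT : T ≤ (X : ℝ) := (Nat.le_ceil T).trans (by exact_mod_cast hX)
  have h2XT : T ≤ ((2 * X : ℕ) : ℝ) := hXT.trans (by exact_mod_cast Nat.le_mul_of_pos_left X two_pos)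
  exact ⟨hT _ hXT, hT _ h2XT⟩

/-! ## The composition: the three stub statements prove the crux -/

/-- **Composition, hypothesis form (sorry-free).** Type-I for `λ(·+2)` at level `1/2 − ε` (all `ε`, `B`),
lopsided Type-II for `λ(·+2)` (all `ε`, `B`) and the Ford–Maynard bounded sieve at `ν = 1/5` give the
crux's literal statement: run the sieve on the host `a = 1 − λ(·+2)`, so that
`Σ_{X<p≤2X} (1 − λ(p+2)) ≥ cX/log X`; then `log p·λ(p+2) ≤ log p − log X·(1 − λ(p+2))` for `X < p`, the
window identity `Σ log p = ϑ(2X) − ϑ(X)` and the prime number theorem give `κ = 1 − c/2`. The hypotheses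
are literally the statements of the three stubs. [folklore] -/
theorem PintzDensity_of_bounds
    (hI : ∀ ε : ℝ, 0 < ε → ∀ B : ℕ, ∃ X₀ : ℕ, ∀ X : ℕ, X₀ ≤ X →
      TypeIBound shiftedLiouville (1 / 2 - ε) B X)
    (hII : ∀ ε : ℝ, 0 < ε → ∀ B : ℕ, ∃ X₀ : ℕ, ∀ X : ℕ, X₀ ≤ X →
      TypeIIBound shiftedLiouville ε (1 / 5 - ε) B X)
    (hFM : ∃ ε : ℝ, 0 < ε ∧ ∃ B : ℕ, ∃ c : ℝ, 0 < c ∧ ∃ X₀ : ℕ, ∀ X : ℕ, X₀ ≤ X →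
      ∀ a : ℕ → ℝ, (∀ n : ℕ, 0 ≤ a n ∧ a n ≤ 2) →
        TypeIBound (fun n => a n - 1) (1 / 2 - ε) B X →
        TypeIIBound (fun n => a n - 1) ε (1 / 5 - ε) B X →
          c * (X : ℝ) / Real.log (X : ℝ) ≤ ∑ p ∈ (Finset.Ioc X (2 * X)).filter Nat.Prime, a p) :
    ∃ κ : ℝ, κ < 1 ∧ ∃ x₀ : ℕ, ∀ x : ℕ, x₀ ≤ x →
      ∑ p ∈ (Finset.Ioc x (2 * x)).filter Nat.Prime,
        Real.log (p : ℝ) * (ArithmeticFunction.liouville (p + 2) : ℝ) ≤ κ * (x : ℝ) := by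
  obtain ⟨ε, hε, B, c, hc, X₀, hFM⟩ := hFM
  obtain ⟨X₁, hI⟩ := hI ε hε B
  obtain ⟨X₂, hII⟩ := hII ε hε B
  obtain ⟨X₃, hθ⟩ := theta_window_eventually (δ := c / 8) (by positivity)
  refine ⟨1 - c / 2, by linarith, max (max X₀ X₁) (max (max X₂ X₃) 2), fun X hX => ?_⟩
  simp only [max_le_iff] at hX
  obtain ⟨⟨hX0, hX1⟩, ⟨hX2, hX3⟩, hX2'⟩ := hX
  -- the host `a = 1 − λ(·+2)` takes values in `{0, 2}`
  set a : ℕ → ℝ := fun n => 1 - shiftedLiouville n with ha_def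
  have ha : ∀ n : ℕ, 0 ≤ a n ∧ a n ≤ 2 := by
    intro n
    rcases shiftedLiouville_eq_or n with h | h <;> norm_num [ha_def, h]
  have ha1 : (fun n => a n - 1) = fun n => -shiftedLiouville n := by
    funext n; simp [ha_def]
  -- the sieve output on this host
  have hsieve : c * (X : ℝ) / Real.log (X : ℝ) ≤
      ∑ p ∈ (Finset.Ioc X (2 * X)).filter Nat.Prime, a p := by
    refine hFM X hX0 a ha ?_ ?_
    · rw [ha1]; exact typeI_neg (hI X hX1)
    · rw [ha1]; exact typeII_neg (hII X hX2)
  -- positivity of `log X`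
  have hXpos : (0 : ℝ) < X := by exact_mod_cast (by omega : 0 < X)
  have hlogX : 0 < Real.log (X : ℝ) := Real.log_pos (by exact_mod_cast (by omega : 1 < X))
  have hcX : c * (X : ℝ) ≤ Real.log (X : ℝ) * ∑ p ∈ (Finset.Ioc X (2 * X)).filter Nat.Prime, a p := by
    have := (div_le_iff₀ hlogX).1 hsieve
    linarith [this]
  -- pointwise: `log p · λ(p+2) ≤ log p − log X · (1 − λ(p+2))` for `X < p`
  have hpt : ∀ p ∈ (Finset.Ioc X (2 * X)).filter Nat.Prime,
      Real.log (p : ℝ) * (ArithmeticFunction.liouville (p + 2) : ℝ)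
        ≤ Real.log (p : ℝ) - Real.log (X : ℝ) * a p := by
    intro p hp
    simp only [Finset.mem_filter, Finset.mem_Ioc] at hp
    have hXp : Real.log (X : ℝ) ≤ Real.log (p : ℝ) :=
      Real.log_le_log hXpos (by exact_mod_cast hp.1.1.le)
    have hap : 0 ≤ a p := (ha p).1
    have hlam : (ArithmeticFunction.liouville (p + 2) : ℝ) = shiftedLiouville p := rfl
    have hrew : Real.log (p : ℝ) * shiftedLiouville p
        = Real.log (p : ℝ) - Real.log (p : ℝ) * a p := by
      simp only [ha_def]; ring
    rw [hlam, hrew]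
    have := mul_le_mul_of_nonneg_right hXp hap
    linarith
  -- sum it
  have hsum : ∑ p ∈ (Finset.Ioc X (2 * X)).filter Nat.Prime,
        Real.log (p : ℝ) * (ArithmeticFunction.liouville (p + 2) : ℝ)
      ≤ (∑ p ∈ (Finset.Ioc X (2 * X)).filter Nat.Prime, Real.log (p : ℝ))
          - Real.log (X : ℝ) * ∑ p ∈ (Finset.Ioc X (2 * X)).filter Nat.Prime, a p := by
    calc ∑ p ∈ (Finset.Ioc X (2 * X)).filter Nat.Prime,
          Real.log (p : ℝ) * (ArithmeticFunction.liouville (p + 2) : ℝ)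
        ≤ ∑ p ∈ (Finset.Ioc X (2 * X)).filter Nat.Prime,
            (Real.log (p : ℝ) - Real.log (X : ℝ) * a p) := Finset.sum_le_sum hpt
      _ = _ := by rw [Finset.sum_sub_distrib, Finset.mul_sum]
  -- the prime number theorem on the window
  rw [sum_log_window X] at hsum
  obtain ⟨hθ1, hθ2⟩ := hθ X hX3
  have h2X : ((2 * X : ℕ) : ℝ) = 2 * (X : ℝ) := by push_cast; ring
  rw [h2X] at hsum hθ2
  rw [abs_le] at hθ1 hθ2
  obtain ⟨hθ1l, -⟩ := hθ1
  obtain ⟨-, hθ2u⟩ := hθ2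
  have hcXnn : (0 : ℝ) ≤ c * X := by positivity
  linarith [hsum, hcX, hθ1l, hθ2u, hcXnn]

/-- **THE SKELETON THEOREM.** The crux
`Summit.Parity.GeneralizedHardyLittlewood.Theses.ParityLeakOneFifth.PintzDensity`, concluded BY NAME from the
three declared stubs through the sorry-free composition `PintzDensity_of_bounds` (`sorry` enters only through
the stub constants). [folklore] -/
theorem PintzDensity_of : PintzDensity :=
  PintzDensity_of_bounds stub_typeI_liouville_half stub_typeII_liouville_lopsided
    stub_bounded_sieve_one_fifth

end Summit.Parity.GeneralizedHardyLittlewood.Cruxes.PintzDensity.Birth
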